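import Literature.Geometry.Riemannian.GaussBonnetGradient
import Literature.Geometry.Manifold.CompleteFlow
import Literature.Geometry.Riemannian.ShrinkerScalarCurvatureNonnegHolds
import Literature.Geometry.Riemannian.ShrinkerPotentialProper
import Summits.SmoothPoincare4.SmoothPoincare4.Theorems.EntropyRungNoncompactShrinkerGapGradientFlow
import HarnessLib

/-!
# Helper `helper_shrinkerEssentialBlowupSequence` of line `collapsed-ends-usc` (crux
# `EntropyRung.NoncompactShrinkerGap`, stmt-SmoothPoincare4-10868): the essential blow-up sequence
# of a gradient shrinker with non-decaying scalar curvature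

Registered helper stub (lead c15, wave 4, brick 3c of the printed chain of route item 16588,
`shrinkerSplittingAtInfinity_four`): let `(Mⁿ, g, f)` be a complete connected normalised gradient
shrinking Ricci soliton (`Ric + Hess f = g/2`, `R + |∇f|² = f`, closed `g.edist`-balls compact),
with `R ≤ A` and with NON-DECAYING scalar curvature — every compact set misses a point with
`R ≥ ε` — and let `θ : ℝ × M → M` be the global flow of `∇f` (`helper_shrinkerGradientFlow`),
`f(θ(t, p)) ≤ eᵗ f(p)` for `t ≥ 0`. Then there are base points `q_k → q*` on the compact level
set `{f = A + 1}` and times `τ_k ≥ 0`, `τ_k → ∞`, with `R(θ(τ_k, q_k)) ≥ ε`. Along the canonical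
Ricci flow `g(t) = (1 − t) ψ_t^* g`, `ψ_t = θ(−log(1 − t), ·)` (`helper_shrinkerCanonicalFlow_of`)
this is an *essential blow-up sequence* `(q_k, t_k = 1 − e^{−τ_k})` in the sense of
Enders–Müller–Topping (Def. 1.2): `|Rm_{g(t_k)}|(q_k) ≥ (ε / c) / (1 − t_k)`, so `q*` is a Type I
singular point.

Proof. (i) `R ≥ 0` (`shrinkerScalarCurvature_nonneg_holds`) makes the potential proper
(`Shrinker.isCompact_potential_le`), so the hypothesis produces points `x_k` with
`f(x_k) > max(k, A + 1)` and `R(x_k) ≥ ε`. (ii) Along the orbit `u(t) = f(θ(t, x_k))` one has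
`u' = |∇f|² = f − R ≥ u − A` (`hasDerivAt_comp_of_isMIntegralCurveOn_grad`), so `u − id` is
non-decreasing on `(−∞, 0]` as long as `u > A + 1`, forcing `u(−S) ≤ A + 1` for
`S = u(0) − (A + 1)`; the intermediate value theorem gives `s_k ≤ 0` with `f(θ(s_k, x_k)) = A + 1`
(`exists_nonpos_eq_of_hasDerivAt_ge`, `exists_flow_level_eq`). Put `q_k = θ(s_k, x_k)`,
`τ_k = −s_k`; the group law returns `θ(τ_k, q_k) = x_k`. (iii) `k < f(x_k) ≤ e^{τ_k} (A + 1)`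
gives `τ_k → ∞`. (iv) The level set `{f = A + 1}` is compact, so a subsequence of `q_k`
converges (`IsCompact.tendsto_subseq`). Everything is proved; no definitions, no named facts.

## References

* [EndersMullerTopping2010] J. Enders, R. Müller, P. M. Topping, *On Type I singularities in
  Ricci flow*, Comm. Anal. Geom. 19 (2011), Def. 1.2.
* [Naber2010] A. Naber, *Noncompact shrinking four solitons with nonnegative curvature*,
  J. reine angew. Math. 645 (2010), Lemma 1.1.
-/

noncomputable section

-- `Summit.SmoothPoincare4.SmoothPoincare4.…` (summit = problem) trips `dupNamespace` on every decl.
set_option linter.dupNamespace false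

open scoped Manifold ContDiff ENNReal NNReal Topology
open MeasureTheory Set Filter Module
open Literature.Geometry.Lorentzian Literature.Geometry.Riemannian Literature.Geometry.Manifold

namespace Summit.SmoothPoincare4.SmoothPoincare4.Theorems.NoncompactShrinkerGapNoncollapsing

/-! ### A real-variable lemma: `u' ≥ u − A` forces `u` down to the level `A + 1` in the past -/

/-- If `u : ℝ → ℝ` is differentiable with `u' ≥ u − A` on `(−∞, 0]` and `u 0 > A + 1`, then
`u s = A + 1` for some `s ≤ 0`: otherwise `u − id` is non-decreasing on `(−∞, 0]`, giving
`u(−S) ≤ A + 1` at `S = u 0 − (A + 1)`; conclude by the intermediate value theorem. [folklore] -/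
theorem exists_nonpos_eq_of_hasDerivAt_ge {u u' : ℝ → ℝ} {A : ℝ}
    (hu : ∀ s, HasDerivAt u (u' s) s) (hu' : ∀ s, s ≤ 0 → u s - A ≤ u' s) (h0 : A + 1 < u 0) :
    ∃ s, s ≤ 0 ∧ u s = A + 1 := by
  -- first a time `S ≤ 0` with `u S ≤ A + 1`
  obtain ⟨S, hS0, hS⟩ : ∃ S, S ≤ 0 ∧ u S ≤ A + 1 := by
    by_contra h
    have h' : ∀ S, S ≤ 0 → A + 1 < u S := fun S hS ↦ not_le.1 fun hle ↦ h ⟨S, hS, hle⟩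
    have hmono : MonotoneOn (fun s ↦ u s - s) (Iic 0) :=
      monotoneOn_of_hasDerivAt_nonneg ordConnected_Iic (u' := fun s ↦ u' s - 1)
        (fun s _ ↦ (hu s).sub (hasDerivAt_id' s)) fun s hs ↦ by
          have h1 := hu' s hs
          have h2 := h' s hs
          show 0 ≤ u' s - 1
          linarith
    have h1 : -(u 0 - (A + 1)) ∈ Iic (0 : ℝ) := by
      rw [mem_Iic]; linarith
    have h2 := hmono h1 (mem_Iic.2 le_rfl) (by linarith)
    have h3 := h' _ (mem_Iic.1 h1)
    simp only [sub_neg_eq_add, sub_zero] at h2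
    linarith
  -- then the intermediate value theorem on `[S, 0]`
  have hcont : ContinuousOn u (Icc S 0) := fun s _ ↦ (hu s).continuousAt.continuousWithinAt
  obtain ⟨s, hs, hsu⟩ := intermediate_value_Icc hS0 hcont ⟨hS, h0.le⟩
  exact ⟨s, hs.2, hsu⟩

/-! ### Flowing back to a level set of `f` along the gradient flow -/

section Generic

variable {E : Type*} [NormedAddCommGroup E] [NormedSpace ℝ E] [FiniteDimensional ℝ E]
  {M : Type*} [TopologicalSpace M] [ChartedSpace E M] [IsManifold 𝓘(ℝ, E) ∞ M]
  (g : PseudoRiemannianMetric 𝓘(ℝ, E) ∞ E (TangentSpace 𝓘(ℝ, E) : M → Type _))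

/-- Let `θ` be a flow of `grad_g f` (`θ(0, ·) = id`, orbits are integral curves) for a smooth `f`
with `|∇f|²_g ≥ f − A`. Then every point `x` with `f x > A + 1` is reached from the level set
`{f = A + 1}`: `f(θ(s, x)) = A + 1` for some `s ≤ 0`, because `u(t) = f(θ(t, x))` satisfies
`u' = |∇f|² ∘ θ(·, x) ≥ u − A`. [folklore] -/
theorem exists_flow_level_eq {f : M → ℝ} (hf : ContMDiff 𝓘(ℝ, E) 𝓘(ℝ, ℝ) ∞ f) {θ : ℝ × M → M}
    (hθ0 : ∀ p, θ (0, p) = p) (hθint : ∀ p, IsMIntegralCurve (fun t ↦ θ (t, p)) (grad g f))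
    {A : ℝ} (hA : ∀ y, f y - A ≤ g.gradSq f y) {x : M} (hx : A + 1 < f x) :
    ∃ s, s ≤ 0 ∧ f (θ (s, x)) = A + 1 := by
  have hu : ∀ s, HasDerivAt (fun t ↦ f (θ (t, x))) (g.gradSq f (θ (s, x))) s := fun s ↦
    hasDerivAt_comp_of_isMIntegralCurveOn_grad g hf isOpen_univ ((hθint x).isMIntegralCurveOn _)
      (mem_univ s)
  have h0 : A + 1 < f (θ (0, x)) := by rwa [hθ0]
  exact exists_nonpos_eq_of_hasDerivAt_ge (u := fun t ↦ f (θ (t, x))) hu (fun s _ ↦ hA _) h0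

end Generic

/-! ### The registered stub -/

/-- Registered helper `helper_shrinkerEssentialBlowupSequence` (lead c15, wave 4): **the essential
blow-up sequence of a gradient shrinker with non-decaying scalar curvature.** For a complete
connected normalised gradient shrinking soliton `(Mⁿ, g, f)` (`Ric + Hess f = g/2`,
`R + |∇f|² = f`, closed `g.edist`-balls compact) with `R ≤ A`, an `ε > 0` such that every compact
set misses a point with `R ≥ ε`, and the smooth global flow `θ` of `∇f` (`θ(0, ·) = id`, group
law, orbits integral curves of `grad_g f`, `f(θ(t, p)) ≤ eᵗ f(p)` for `t ≥ 0`), there are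
`q_k → q*` with `f(q_k) = f(q*) = A + 1` and `τ_k ≥ 0`, `τ_k → ∞`, with `R(θ(τ_k, q_k)) ≥ ε` — the
base points and times `t_k = 1 − e^{−τ_k} ↗ 1` of an essential blow-up sequence of the shrinker's
canonical Type I Ricci flow (Enders–Müller–Topping, Def. 1.2). Proof: properness of `f`
(`Shrinker.isCompact_potential_le`, `R ≥ 0` by `shrinkerScalarCurvature_nonneg_holds`) gives
escaping `x_k` with `f(x_k) > max(k, A + 1)`, `R(x_k) ≥ ε`; flowing back along `θ`
(`exists_flow_level_eq`) lands on `{f = A + 1}` at `q_k = θ(−τ_k, x_k)`;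
`k < f(x_k) ≤ e^{τ_k}(A + 1)` forces `τ_k → ∞`; compactness of `{f = A + 1}` extracts
`q_k → q*`. [cite: EndersMullerTopping2010, Def. 1.2] -/
theorem helper_shrinkerEssentialBlowupSequence : ∀ (n : ℕ) (M : Type) [TopologicalSpace M] [T2Space M] [SecondCountableTopology M] [ChartedSpace (EuclideanSpace ℝ (Fin n)) M] [IsManifold (𝓡 n) ∞ M] [ConnectedSpace M] [T3Space M] [MeasurableSpace M] [BorelSpace M] (g : PseudoRiemannianMetric (𝓡 n) ∞ (EuclideanSpace ℝ (Fin n)) (TangentSpace (𝓡 n) : M → Type _)) [g.HasLeviCivita] (f : M → ℝ) (hg : g.IsRiemannian), (∀ (x : M) (r : NNReal), IsCompact {y : M | g.edist hg x y ≤ r}) → ContMDiff (𝓡 n) 𝓘(ℝ, ℝ) ∞ f → (∀ (x : M) (X Y : TangentSpace (𝓡 n) x), g.ricci x X Y + g.hessian f x X Y = (1 / 2 : ℝ) * g.val x X Y) → (∀ x : M, g.scalarCurvature x + g.gradSq f x = f x) → ∀ A : ℝ, (∀ x : M, g.scalarCurvature x ≤ A) → ∀ ε : ℝ, 0 < ε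 → (∀ K : Set M, IsCompact K → ∃ x, x ∉ K ∧ ε ≤ g.scalarCurvature x) → ∀ θ : ℝ × M → M, ContMDiff (𝓘(ℝ, ℝ).prod (𝓡 n)) (𝓡 n) ∞ θ → (∀ p, θ (0, p) = p) → (∀ t s p, θ (t, θ (s, p)) = θ (t + s, p)) → (∀ p, IsMIntegralCurve (fun t ↦ θ (t, p)) (Literature.Geometry.Riemannian.grad g f)) → (∀ p t, 0 ≤ t → f (θ (t, p)) ≤ Real.exp t * f p) → ∃ (q : ℕ → M) (qstar : M) (τ : ℕ → ℝ), Tendsto q atTop (𝓝 qstar) ∧ f qstar = A + 1 ∧ (∀ k, f (q k) = A + 1) ∧ (∀ k, 0 ≤ τ k) ∧ Tendsto τ atTop atTop ∧ ∀ k, ε ≤ g.scalarCurvature (θ (τ k, q k)) := by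
  intro n M _ _ _ _ _ _ _ _ _ g _ f hg hc hf hsol hnorm A hA ε _ hesc θ _ hθ0 hθadd hθint hθexp
  -- `R ≥ 0`, the potential is proper, `|∇f|² = f − R ≥ f − A`, and `A + 1 > 0`
  have hR : ∀ x : M, 0 ≤ g.scalarCurvature x :=
    shrinkerScalarCurvature_nonneg_holds n M g f hg hc hf hsol hnorm
  have hK : ∀ c : ℝ, IsCompact {y : M | f y ≤ c} :=
    Shrinker.isCompact_potential_le g hg hc hf hsol hnorm hR
  have hgradA : ∀ y, f y - A ≤ g.gradSq f y := fun y ↦ by linarith [hA y, hnorm y]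
  obtain ⟨x₀⟩ : Nonempty M := inferInstance
  have hA1 : 0 < A + 1 := by linarith [hR x₀, hA x₀]
  -- (i) escaping points `x k` with `R ≥ ε` and `f > max k (A + 1)`
  have hx : ∀ k : ℕ, ∃ x : M, max (k : ℝ) (A + 1) < f x ∧ ε ≤ g.scalarCurvature x := fun k ↦ by
    obtain ⟨x, hxK, hxε⟩ := hesc _ (hK (max (k : ℝ) (A + 1)))
    simp only [mem_setOf_eq, not_le] at hxK
    exact ⟨x, hxK, hxε⟩
  choose x hxf hxε using hx
  -- (ii) flow back to the level set `{f = A + 1}`: `q k = θ (s k, x k)`, `τ k = - s k`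
  have hs : ∀ k : ℕ, ∃ s : ℝ, s ≤ 0 ∧ f (θ (s, x k)) = A + 1 := fun k ↦
    exists_flow_level_eq g hf hθ0 hθint hgradA ((le_max_right _ _).trans_lt (hxf k))
  choose s hs0 hsf using hs
  have hback : ∀ k, θ (-s k, θ (s k, x k)) = x k := fun k ↦ by
    rw [hθadd, neg_add_cancel, hθ0]
  -- (iii) `τ k → ∞` from `k < f (x k) ≤ exp (τ k) * (A + 1)`
  have hτ : Tendsto (fun k ↦ -s k) atTop atTop := by
    refine tendsto_atTop_atTop.2 fun b ↦
      ⟨⌈Real.exp b * (A + 1)⌉₊, fun k hk ↦ not_lt.1 fun hlt ↦ ?_⟩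
    have h1 : (k : ℝ) < Real.exp (-s k) * (A + 1) := by
      have h := hθexp (θ (s k, x k)) (-s k) (by linarith [hs0 k])
      rw [hback, hsf] at h
      linarith [(le_max_left _ _).trans_lt (hxf k)]
    have h2 : Real.exp (-s k) * (A + 1) ≤ Real.exp b * (A + 1) :=
      mul_le_mul_of_nonneg_right (Real.exp_le_exp.2 hlt.le) hA1.le
    have h3 : Real.exp b * (A + 1) ≤ k := (Nat.le_ceil _).trans (Nat.cast_le.2 hk)
    linarith
  -- (iv) the level set `{f = A + 1}` is compact: extract a convergent subsequence of `q`
  have hL : IsCompact {y : M | f y = A + 1} :=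
    (hK (A + 1)).of_isClosed_subset (isClosed_eq hf.continuous continuous_const)
      fun y (hy : f y = A + 1) ↦ show f y ≤ A + 1 from hy.le
  obtain ⟨qstar, hqstar, φ, hφ, hlim⟩ :=
    hL.tendsto_subseq (x := fun k ↦ θ (s k, x k)) fun k ↦ hsf k
  refine ⟨fun k ↦ θ (s (φ k), x (φ k)), qstar, fun k ↦ -s (φ k), hlim, hqstar, fun k ↦ hsf _,
    fun k ↦ by linarith [hs0 (φ k)], hτ.comp hφ.tendsto_atTop, fun k ↦ ?_⟩
  simpa only [hback] using hxε (φ k)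

end Summit.SmoothPoincare4.SmoothPoincare4.Theorems.NoncompactShrinkerGapNoncollapsing

end
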